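import Literature.AnabelianGeometry.AbsoluteAnabelian.AbsTopIII.KummerCurveLaws
import Literature.AnabelianGeometry.AbsoluteAnabelian.AbsTopIII.Thm19cProofs
import HarnessLib

/-!
# [AbsTopIII] Thm. 1.9 (c): `P_U^{gt} = P_U` for every law-abiding model — the closer of `Thm19c`
# over the successor structure `NaturalKummerModel` (proof-only)

Mochizuki, *Topics in Absolute Anabelian Geometry III*, §1, Thm. 1.9 (c) p. 37 ("the subgroup
`P_U ⊆ H¹(Π_U, μ_Ẑ(Π_U))` determined by the cuspidal principal divisors via the isomorphisms of (b) and the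
characterization of principal divisors given in Proposition 1.6, (ii)") and Prop. 1.6 (iii) p. 35 ("the
image [via `κ_U`] of `Γ(U, 𝒪_U^×)` [...] is equal to the inverse image [...] of the submodule of `⊕ ℤ ⊆ ⊕ Ẑ`
determined by the principal divisors"; lit key `paper:url-5493eb38cbb7`).

Proof-only companion (abc-iut-L4-t1, interface owner) of `KummerCurveLaws.lean` and of abc-iut-w5-d213's
`Thm19cProofs.lean` (`IntrinsicKummerModel.thm19c_of_cuspidalLaws`: `Thm19c` from `Prop_1_6_iii_ker` BY
NAME and the two CUSPIDAL LAWS (L1) "`κ_U(f) ∈ P_U^{gt}`" / (L2) "principal cuspidal divisors are realised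
by regular units" as ONE explicit hypothesis).  Here (L1) and (L2) are DERIVED for every
`M : NaturalKummerModel` from the per-curve laws — `kummer_degree` (the degree law, Prop. 1.6 (iii) read
through the (b)-presentations; definitionally abc-iut-w5-d213's `HasCuspidalDegree`), `fieldRes` /
`ptRes` / `ord_ptRes` / `cuspPt` ("`K_U = K_Z`", "`U = Z ∖ S`"), and `point_eq_of_decomp_conj` (the filled
point `P.pt z` of a presentation IS the model's point, `CuspSyncPresentation.pt_eq_of_cuspPt`) — whence

* `NaturalKummerModel.thm19c (hker : M.Prop_1_6_iii_ker) : M.Thm19c`.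

Also: transport of (torally) Kummer-faithfulness along a field isomorphism (`k_U = k_Z`).  All declarations
are theorems; no new facts.  HONEST FRAMING: the per-curve laws are interface laws (typing policy θ), so
this discharges sub-DAG row Thm19.c.r6 at every law-abiding model modulo the named fact `Prop_1_6_iii_ker`;
nothing here bears on [IUTchIII] Cor. 3.12.
-/

noncomputable section

open CategoryTheory
open scoped Classical Pointwise

namespace Literature.AnabelianGeometry.AbsoluteAnabelian.AbsTopIII

universe u

/-! ### Kummer-faithfulness is invariant under field isomorphisms -/

/-- Torally Kummer-faithful fields are stable under isomorphism of fields (Def. 1.5 is a property of the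
isomorphism class of `k`). [cite: MochizukiAbsTopIII2015, Def 1.5 p.32] -/
theorem IsTorallyKummerFaithful.of_ringEquiv {k k₂ : Type u} [Field k] [Field k₂] (e : k ≃+* k₂)
    (hk : IsTorallyKummerFaithful k) : IsTorallyKummerFaithful k₂ := by
  haveI := hk.charZero
  refine ⟨charZero_of_injective_ringHom (f := e.toRingHom) e.injective, fun k' _ _ hfin => ?_⟩
  letI : Algebra k k₂ := e.toRingHom.toAlgebra
  letI : Algebra k k' := ((algebraMap k₂ k').comp e.toRingHom).toAlgebra
  haveI : IsScalarTower k k₂ k' := IsScalarTower.of_algebraMap_eq fun _ => rfl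
  haveI : Module.Finite k k₂ :=
    Module.Finite.of_surjective (Algebra.linearMap k k₂) e.surjective
  haveI : Module.Finite k k' := Module.Finite.trans k₂ k'
  exact hk.units k' inferInstance

/-- Kummer-faithful fields are stable under isomorphism of fields.
[cite: MochizukiAbsTopIII2015, Def 1.5 p.32] -/
theorem IsKummerFaithful.of_ringEquiv {k k₂ : Type u} [Field k] [Field k₂] (e : k ≃+* k₂)
    (hk : IsKummerFaithful k) : IsKummerFaithful k₂ := by
  haveI := hk.torally.charZero
  refine ⟨hk.torally.of_ringEquiv e, fun k' _ _ hfin A => ?_⟩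
  letI : Algebra k k₂ := e.toRingHom.toAlgebra
  letI : Algebra k k' := ((algebraMap k₂ k').comp e.toRingHom).toAlgebra
  haveI : IsScalarTower k k₂ k' := IsScalarTower.of_algebraMap_eq fun _ => rfl
  haveI : Module.Finite k k₂ :=
    Module.Finite.of_surjective (Algebra.linearMap k k₂) e.surjective
  haveI : Module.Finite k k' := Module.Finite.trans k₂ k'
  exact hk.abelianVariety k' inferInstance A

namespace NaturalKummerModel

variable (M : NaturalKummerModel.{u})

/-! ### The filled point of a presentation is the model's point -/

/-- The base field of a cofinite open `U ⊆ Z` is Kummer-faithful iff that of `Z` is (`k_U = k_Z`, law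
`baseRes`). [cite: MochizukiAbsTopIII2015, Def 1.5 p.32] -/
theorem isKummerFaithful_base_of_isCofiniteOpen {U Z : M.Curve} (h : M.IsCofiniteOpen U Z)
    (hk : IsKummerFaithful (M.base U)) : IsKummerFaithful (M.base Z) :=
  hk.of_ringEquiv (M.baseRes h).symm

/-- **The point `P.pt z` filled by the cusp `z` according to a presentation IS the model's filled point**
(`cuspPt`): both have decomposition groups conjugate to the image of `D_z`, and decomposition groups
separate the closed points of a proper curve of genus `≥ 2` over a Kummer-faithful field (law
`point_eq_of_decomp_conj`). [cite: MochizukiAbsTopIII2015, Thm 1.9 (b) p.37] -/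
theorem pt_eq_of_cuspPt {U Z : M.Curve} {h : M.IsCofiniteOpen U Z}
    (P : M.toCurveModel.CuspSyncPresentation h) (hZs : M.IsScheme Z) (hZ : M.IsProper Z)
    (hg : 2 ≤ M.genus Z) (hk : IsKummerFaithful (M.base Z)) (z : (M.cusps U).Cusp) (y : M.Point Z)
    (hy : M.cuspPt h z = some y) : P.pt z = y := by
  obtain ⟨g, hg1⟩ := P.decomp_pt z
  obtain ⟨g', hg2⟩ := M.decomp_cuspPt h z y hy
  refine M.point_eq_of_decomp_conj Z hZs hZ hg hk (P.pt z) y (g⁻¹ * g') ?_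
  rw [map_mul, map_inv, mul_smul, ← hg2, hg1, inv_smul_smul]

/-- With `Z` proper every cusp fills a point: the filled point as a value. (Local abbreviation through
`Option.get`; no definition is introduced.) [cite: MochizukiAbsTopIII2015, Prop 1.6 (iii) p.35] -/
theorem cuspPt_eq_some_get {U Z : M.Curve} (h : M.IsCofiniteOpen U Z) (hZ : M.IsProper Z)
    (z : (M.cusps U).Cusp) :
    M.cuspPt h z = some ((M.cuspPt h z).get (M.cuspPt_isSome h hZ z)) :=
  (Option.some_get _).symm

/-- For `Z` proper, `P.pt` agrees with the model's filled points.
[cite: MochizukiAbsTopIII2015, Thm 1.9 (b) p.37] -/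
theorem pt_eq_get {U Z : M.Curve} {h : M.IsCofiniteOpen U Z}
    (P : M.toCurveModel.CuspSyncPresentation h) (hZs : M.IsScheme Z) (hZ : M.IsProper Z)
    (hg : 2 ≤ M.genus Z) (hk : IsKummerFaithful (M.base Z)) (z : (M.cusps U).Cusp) :
    P.pt z = (M.cuspPt h z).get (M.cuspPt_isSome h hZ z) :=
  M.pt_eq_of_cuspPt P hZs hZ hg hk z _ (M.cuspPt_eq_some_get h hZ z)

/-! ### Divisor bookkeeping along `U ⊆ Z` -/

/-- A point of `U` is not a filled point. [cite: MochizukiAbsTopIII2015, Prop 1.6 (iii) p.35] -/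
theorem get_cuspPt_ne_ptRes {U Z : M.Curve} (h : M.IsCofiniteOpen U Z) (hZ : M.IsProper Z)
    (z : (M.cusps U).Cusp) (x : M.Point U) :
    (M.cuspPt h z).get (M.cuspPt_isSome h hZ z) ≠ M.ptRes h x := by
  intro hx
  exact M.cuspPt_ne_ptRes h z x (by rw [← hx]; exact M.cuspPt_eq_some_get h hZ z)

/-- The cuspidal divisor of a presentation vanishes at the points of `U` (for `Z` proper over a
Kummer-faithful field, where `P.pt = cuspPt`). [cite: MochizukiAbsTopIII2015, Thm 1.9 (c) p.37] -/
theorem cuspidalDivisor_ptRes {U Z : M.Curve} {h : M.IsCofiniteOpen U Z}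
    (P : M.toCurveModel.CuspSyncPresentation h) (hZs : M.IsScheme Z) (hZ : M.IsProper Z)
    (hg : 2 ≤ M.genus Z) (hk : IsKummerFaithful (M.base Z)) (D : (M.cusps U).Cusp → ℤ)
    (x : M.Point U) : P.cuspidalDivisor D (M.ptRes h x) = 0 := by
  unfold CurveModel.CuspSyncPresentation.cuspidalDivisor
  rw [Finsupp.finsetSum_apply]
  refine Finset.sum_eq_zero fun z _ => ?_
  rw [Finsupp.single_apply, if_neg]
  rw [M.pt_eq_get P hZs hZ hg hk z]
  exact M.get_cuspPt_ne_ptRes h hZ z x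

/-- The cuspidal divisor of a presentation at the point filled by `z` is `D z`.
[cite: MochizukiAbsTopIII2015, Thm 1.9 (c) p.37] -/
theorem cuspidalDivisor_pt {U Z : M.Curve} {h : M.IsCofiniteOpen U Z}
    (P : M.toCurveModel.CuspSyncPresentation h) (D : (M.cusps U).Cusp → ℤ) (z : (M.cusps U).Cusp) :
    P.cuspidalDivisor D (P.pt z) = D z := by
  unfold CurveModel.CuspSyncPresentation.cuspidalDivisor
  rw [Finsupp.finsetSum_apply]
  rw [Finset.sum_eq_single z]
  · rw [Finsupp.single_eq_same]
  · intro z' _ hz'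
    rw [Finsupp.single_apply, if_neg]
    exact fun heq => hz' (P.pt_injective heq)
  · intro hz
    exact (hz (@Finset.mem_univ _ (Fintype.ofFinite _) z)).elim

/-- The rational function of `Z` underlying a regular unit of `U` ("`K_U = K_Z`").
(Notation inside proofs only.) [cite: MochizukiAbsTopIII2015, Prop 1.6 p.34] -/
theorem coe_map_fieldRes_symm {U Z : M.Curve} (h : M.IsCofiniteOpen U Z) (f : (M.FunctionField U)ˣ) :
    Units.map (M.fieldRes h).toRingHom.toMonoidHom
        (Units.map (M.fieldRes h).symm.toRingHom.toMonoidHom f) = f := by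
  ext
  simp

/-- Conversely. [cite: MochizukiAbsTopIII2015, Prop 1.6 p.34] -/
theorem map_fieldRes_symm_map {U Z : M.Curve} (h : M.IsCofiniteOpen U Z) (g : (M.FunctionField Z)ˣ) :
    Units.map (M.fieldRes h).symm.toRingHom.toMonoidHom
        (Units.map (M.fieldRes h).toRingHom.toMonoidHom g) = g := by
  ext
  simp

/-! ### (L1): the Kummer class of a regular unit lies in `P_U^{gt}` -/

/-- **(L1) "`κ_U(f) ∈ P_U^{gt}`"**: the Kummer class of a regular unit `f` of `U` has the integral cuspidal
degrees `degSign · ord_y(f)` at the cusps (law `kummer_degree` at the presentation's third curves), and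
these form a principal divisor of `Z` (the divisor of `f^{±1}` itself: it has no zeros or poles on `U`,
laws `ord_ptRes` / `exists_ptRes_or_cuspPt`). [cite: MochizukiAbsTopIII2015, Thm 1.9 (c) p.37] -/
theorem kummer_mem_PUgt {U Z : M.Curve} {h : M.IsCofiniteOpen U Z} (hZ : M.IsProper Z)
    (hZs : M.IsScheme Z) (hg : 2 ≤ M.genus Z) (hk : IsKummerFaithful (M.base Z))
    (P : M.toCurveModel.CuspSyncPresentation h) (f : M.regularUnits U) :
    Multiplicative.toAdd (M.kummerMap h hZ f) ∈ M.PUgt P := by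
  set g : (M.FunctionField Z)ˣ :=
    Units.map (M.fieldRes h).symm.toRingHom.toMonoidHom (f : (M.FunctionField U)ˣ) with hgdef
  refine ⟨fun z => (M.degSign : ℤ) *
      Multiplicative.toAdd (M.ord ((M.cuspPt h z).get (M.cuspPt_isSome h hZ z)) g), ?_, ?_⟩
  · intro z
    exact M.kummer_degree (P.hU z) (P.hZ z) h hZ z (P.cusp z) (P.pres z) (P.inertia_le z)
      (P.inertia_bijOn z) _ (M.cuspPt_eq_some_get h hZ z) (P.sec z) (P.bij z) f
  · refine ⟨g ^ (M.degSign : ℤ), fun y => ?_⟩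
    rw [map_zpow, toAdd_zpow, smul_eq_mul]
    rcases M.exists_ptRes_or_cuspPt h y with ⟨x, rfl⟩ | ⟨c, hc⟩
    · rw [M.cuspidalDivisor_ptRes P hZs hZ hg hk, M.ord_ptRes h x g, hgdef,
        M.coe_map_fieldRes_symm h, f.2 x]
      simp
    · have hpt : P.pt c = y := M.pt_eq_of_cuspPt P hZs hZ hg hk c y hc
      rw [← hpt, M.cuspidalDivisor_pt P, M.pt_eq_get P hZs hZ hg hk c]

/-! ### (L2): principal cuspidal divisors are realised by regular units -/

/-- **(L2) REALIZATION**: a principal divisor of `Z` supported on the points filled by the cusps of `U`,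
`D = div(g)`, is realised by the regular unit `f := (g|_U)^{±1}` of `U` (no zeros or poles on `U`, laws
`ord_ptRes` / `cuspPt_ne_ptRes`), whose Kummer class has cuspidal degrees `D` (law `kummer_degree`;
`degSign² = 1`). [cite: MochizukiAbsTopIII2015, Thm 1.9 (c) p.37] -/
theorem exists_regularUnit_realizing {U Z : M.Curve} {h : M.IsCofiniteOpen U Z} (hZ : M.IsProper Z)
    (hZs : M.IsScheme Z) (hg : 2 ≤ M.genus Z) (hk : IsKummerFaithful (M.base Z))
    (P : M.toCurveModel.CuspSyncPresentation h) (D : (M.cusps U).Cusp → ℤ)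
    (hD : M.IsPrincipal (P.cuspidalDivisor D)) :
    ∃ f : M.regularUnits U,
      ∀ z, CurveModel.HasCuspidalDegree P (Multiplicative.toAdd (M.kummerMap h hZ f)) z (D z) := by
  obtain ⟨g, hgD⟩ := hD
  -- the restriction of `g^{±1}` to `U` is a regular unit
  have hreg : Units.map (M.fieldRes h).toRingHom.toMonoidHom (g ^ (M.degSign : ℤ)) ∈ M.regularUnits U := by
    intro x
    rw [← M.ord_ptRes h x, map_zpow]
    have h0 : M.ord (M.ptRes h x) g = 1 := by
      have := hgD (M.ptRes h x)
      rw [M.cuspidalDivisor_ptRes P hZs hZ hg hk D x] at this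
      exact toAdd_eq_zero.mp this
    rw [h0, one_zpow]
  refine ⟨⟨_, hreg⟩, fun z => ?_⟩
  have hdeg := M.kummer_degree (P.hU z) (P.hZ z) h hZ z (P.cusp z) (P.pres z) (P.inertia_le z)
    (P.inertia_bijOn z) _ (M.cuspPt_eq_some_get h hZ z) (P.sec z) (P.bij z) ⟨_, hreg⟩
  have hval : (M.degSign : ℤ) *
      Multiplicative.toAdd (M.ord ((M.cuspPt h z).get (M.cuspPt_isSome h hZ z))
        (Units.map (M.fieldRes h).symm.toRingHom.toMonoidHom
          (Units.map (M.fieldRes h).toRingHom.toMonoidHom (g ^ (M.degSign : ℤ))))) = D z := by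
    rw [M.map_fieldRes_symm_map h, map_zpow, toAdd_zpow, smul_eq_mul, ← mul_assoc,
      Int.units_coe_mul_self, one_mul, ← M.pt_eq_get P hZs hZ hg hk z, hgD (P.pt z),
      M.cuspidalDivisor_pt P D z]
  rw [hval] at hdeg
  exact hdeg

/-! ### The closer -/

/-- **Thm. 1.9 (c) for every law-abiding model**: `P_U^{gt} = P_U` for every cofinite open `U ⊆ Z` as in
(b) and every system of cyclotome presentations `P` — abc-iut-w5-d213's `thm19c_of_cuspidalLaws` with its
cuspidal laws (L1)(L2) DERIVED from the per-curve laws of `NaturalKummerModel`; the only remaining input is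
abc-iut-L4-t1's named fact `Prop_1_6_iii_ker` (exactness of Prop. 1.6 (iii) in kernel form).
[cite: MochizukiAbsTopIII2015, Thm 1.9 (c) p.37] -/
theorem thm19c (hker : M.Prop_1_6_iii_ker) : M.Thm19c := by
  refine M.thm19c_of_cuspidalLaws hker fun U Z h hZ _ hZs hg hk _ P => ?_
  have hkZ : IsKummerFaithful (M.base Z) := M.isKummerFaithful_base_of_isCofiniteOpen h hk
  exact ⟨fun f => M.kummer_mem_PUgt hZ hZs hg hkZ P f,
    fun D hD => M.exists_regularUnit_realizing hZ hZs hg hkZ P D hD⟩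

end NaturalKummerModel

end Literature.AnabelianGeometry.AbsoluteAnabelian.AbsTopIII
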